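import Summits.HodgeConjecture.CorCM.Census.QuarticInversionDictionary

/-!
# The quartic inversion twists, dictionary II: base change along the datum is the model's motion

COR-CM (cell `pub-hodgecm2`, stage 2 of the Hodge ladder), count-neutral KERNEL COMBINATORICS by the binder seat b23 (gen 44; claim
QUARTIC-INVERSION, HOME/INBOX.md l.12829).  Theorems only, on top of `Census/QuarticInversionDictionary.lean` (the datum `D : Datum G c B ζ`, the
labels `ty Ψ ∈ Ty₄ B` of an abstract CM type, `typeOf`, `typeEquiv`) and part I of the lane (`Census/QuarticInversionModel.lean`: the motions
`twH₄`, `twY ζ`, `twT`), used BY NAME; no `decide` beyond closed identities in `ZMod 2`, no certificate, no named fact, no `sorry`.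
`Interfaces.lean` (C1), every E term, B01, `Transposition/*`, `PortJoin/*` untouched.
HONEST FRAMING: `HC_CM` is NOT proved, here or anywhere in the tree; nothing here is a period, a count of record or a headline.

CONTENT (§3 of the dictionary).  Along a quartic inversion datum of square class `ζ` (`ι : ℤ/2 × B ↪ G`, `y` inverting with `y² = ι(ζ,0)`, `t`
centralising with `t² = c`, `y t = c t y`), base change of abstract CM types (`Ψ ↦ Ψ·Q⁻¹ = rt Q Ψ`) reads on the quadruple of labels as:
* **`ty (Ψ·(ι a)⁻¹) = twH₄ a (ty Ψ)`** (`ty_rt_ι`: the diagonal slice twist on all four coordinates),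
* **`ty (Ψ·y⁻¹) = twY ζ (ty Ψ)`** (`ty_rt_y`: `((ψ₀,ψ₁),(ψ₂,ψ₃)) ↦ ((ψ₁(−·), ψ₀(−·)+ζ), (ψ₃(−·), ψ₂(−·)+ζ))`),
* **`ty (Ψ·t⁻¹) = twT (ty Ψ)`** (`ty_rt_t`: `((ψ₀,ψ₁),(ψ₂,ψ₃)) ↦ ((ψ₂, ψ₃+1), (ψ₀+1, ψ₁))`), and `ty (Ψ·c) = twH₄ (1,0) (ty Ψ)`;
equivalently `typeOf (twH₄ a Θ) = (typeOf Θ)·(ι a)⁻¹`, `typeOf (twY ζ Θ) = (typeOf Θ)·y⁻¹`, `typeOf (twT Θ) = (typeOf Θ)·t⁻¹` — so the relations of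
part I (`twY² = twH₄ (ζ,0)`, `twT² = twH₄ c`, `twY twT = twH₄ c twT twY`, …) ARE the relations of `G_ζ(B)` read through Pohlmann's dictionary
[Pohlmann1968, Thm 1].  All [folklore].

## References
* [Pohlmann1968] H. Pohlmann, Algebraic cycles on abelian varieties of complex multiplication type, Ann. of Math. 88 (1968), Thm 1.
* [Milne1999] J. S. Milne, Lefschetz motives and the Tate conjecture, Compositio Math. 117 (1999), Prop. 2.1, p. 54.
-/

namespace Summit.HodgeConjecture.CorCM.Census.QuarticInversion

open Finset
open Summit.HodgeConjecture.CorCM.Prior.AllgGroup.RfwfAllgGroup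
open Summit.HodgeConjecture.CorCM.Census.BlockParity
open Summit.HodgeConjecture.CorCM.Census.OddSliceFacesModel
open Summit.HodgeConjecture.CorCM.Census.DicyclicTwist (Ty₂ rev twH)

noncomputable section

variable {G : Type*} [Group G] [Fintype G] [DecidableEq G] {c : G}
variable {A : Type} [AddCommGroup A] [Fintype A] [DecidableEq A] {ζ : ZMod 2}
variable (D : Datum G c A ζ)

/-- Two elements of `ℤ/2` that vanish together are equal. [folklore] -/
private theorem zmod2_eq_of_iff' : ∀ {u v : ZMod 2}, (u = 0 ↔ v = 0) → u = v := by decide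

/-- `u = e ↔ u + e = 0` in `ℤ/2`. [folklore] -/
private theorem eq_iff_add_eq_zero' : ∀ u e : ZMod 2, u = e ↔ u + e = 0 := by decide

/-! ## §3 Base change is the model's motion -/

/-- `¬ u = 0 ↔ u + 1 = 0` in `ℤ/2`. [folklore] -/
private theorem not_eq_zero_iff_add_one : ∀ u : ZMod 2, ¬ u = 0 ↔ u + 1 = 0 := by decide

omit [Fintype A] [DecidableEq A] in
/-- **Base change along `ι a` is the diagonal twist**: `ty (Ψ·(ι a)⁻¹) = twH₄ a (ty Ψ)`. [folklore] -/
theorem ty_rt_ι (a : ZMod 2 × A) (Ψ : CMF G c) : ty D (rt c (D.ι a) Ψ) = twH₄ A a (ty D Ψ) := by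
  have e1 : ∀ s : A, D.ι (0, s) * D.ι a = D.ι (a.1, s + a.2) := fun s => ι0_mul_ι D s a
  refine Prod.ext (Prod.ext (funext fun s => zmod2_eq_of_iff' ?_) (funext fun s => zmod2_eq_of_iff' ?_))
    (Prod.ext (funext fun s => zmod2_eq_of_iff' ?_) (funext fun s => zmod2_eq_of_iff' ?_))
  · show (ty D (rt c (D.ι a) Ψ)).1.1 s = 0 ↔ (ty D Ψ).1.1 (s + a.2) + a.1 = 0
    rw [← ι_mem_iff, mem_rt, e1, ι_mem_iff]
    exact eq_iff_add_eq_zero' _ _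
  · show (ty D (rt c (D.ι a) Ψ)).1.2 s = 0 ↔ (ty D Ψ).1.2 (s + a.2) + a.1 = 0
    rw [← yι_mem_iff, mem_rt, mul_assoc, e1, yι_mem_iff]
    exact eq_iff_add_eq_zero' _ _
  · show (ty D (rt c (D.ι a) Ψ)).2.1 s = 0 ↔ (ty D Ψ).2.1 (s + a.2) + a.1 = 0
    rw [← tι_mem_iff, mem_rt, mul_assoc, e1, tι_mem_iff]
    exact eq_iff_add_eq_zero' _ _
  · show (ty D (rt c (D.ι a) Ψ)).2.2 s = 0 ↔ (ty D Ψ).2.2 (s + a.2) + a.1 = 0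
    rw [← tyι_mem_iff, mem_rt, mul_assoc, mul_assoc, e1, tyι_mem_iff]
    exact eq_iff_add_eq_zero' _ _

omit [Fintype A] [DecidableEq A] in
/-- **Base change along `y` is the swap-twist of square class `ζ`**: `ty (Ψ·y⁻¹) = twY ζ (ty Ψ)`. [folklore] -/
theorem ty_rt_y (Ψ : CMF G c) : ty D (rt c D.y Ψ) = twY A ζ (ty D Ψ) := by
  have e1 : ∀ s : A, D.ι (0, s) * D.y = D.y * D.ι (0, -s) := fun s => by
    rw [ι_mul_y, Prod.neg_mk, neg_zero]
  have e2 : ∀ s : A, D.y * D.ι (0, s) * D.y = D.ι (ζ, -s) := fun s => by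
    rw [mul_assoc, e1, ← mul_assoc, D.y_mul_y, ← D.map_add, Prod.mk_add_mk, add_zero, zero_add]
  refine Prod.ext (Prod.ext (funext fun s => zmod2_eq_of_iff' ?_) (funext fun s => zmod2_eq_of_iff' ?_))
    (Prod.ext (funext fun s => zmod2_eq_of_iff' ?_) (funext fun s => zmod2_eq_of_iff' ?_))
  · show (ty D (rt c D.y Ψ)).1.1 s = 0 ↔ (ty D Ψ).1.2 (-s) = 0
    rw [← ι_mem_iff, mem_rt, e1, yι_mem_iff]
  · show (ty D (rt c D.y Ψ)).1.2 s = 0 ↔ (ty D Ψ).1.1 (-s) + ζ = 0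
    rw [← yι_mem_iff, mem_rt, e2, ι_mem_iff]
    exact eq_iff_add_eq_zero' _ _
  · show (ty D (rt c D.y Ψ)).2.1 s = 0 ↔ (ty D Ψ).2.2 (-s) = 0
    rw [← tι_mem_iff, mem_rt, mul_assoc, e1, tyι_mem_iff]
  · show (ty D (rt c D.y Ψ)).2.2 s = 0 ↔ (ty D Ψ).2.1 (-s) + ζ = 0
    rw [← tyι_mem_iff, mem_rt, mul_assoc, e2, tι_mem_iff]
    exact eq_iff_add_eq_zero' _ _

omit [Fintype A] [DecidableEq A] in
/-- **Base change along `t`**: `ty (Ψ·t⁻¹) = twT (ty Ψ) = ((ψ₂, ψ₃ + 1), (ψ₀ + 1, ψ₁))`. [folklore] -/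
theorem ty_rt_t (Ψ : CMF G c) : ty D (rt c D.t Ψ) = twT A (ty D Ψ) := by
  have hc : ∀ g : G, c * g ∈ Ψ.1 ↔ g ∉ Ψ.1 := fun g => by have h := Ψ.2 g; tauto
  refine Prod.ext (Prod.ext (funext fun s => zmod2_eq_of_iff' ?_) (funext fun s => zmod2_eq_of_iff' ?_))
    (Prod.ext (funext fun s => zmod2_eq_of_iff' ?_) (funext fun s => zmod2_eq_of_iff' ?_))
  · show (ty D (rt c D.t Ψ)).1.1 s = 0 ↔ (ty D Ψ).2.1 s = 0
    rw [← ι_mem_iff, mem_rt, ι_mul_t, tι_mem_iff]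
  · show (ty D (rt c D.t Ψ)).1.2 s = 0 ↔ (ty D Ψ).2.2 s + 1 = 0
    rw [← yι_mem_iff, mem_rt, mul_assoc, ι_mul_t, ← mul_assoc, D.y_mul_t, mul_assoc, mul_assoc, hc, tyι_mem_iff]
    exact not_eq_zero_iff_add_one _
  · show (ty D (rt c D.t Ψ)).2.1 s = 0 ↔ (ty D Ψ).1.1 s + 1 = 0
    rw [← tι_mem_iff, mem_rt, mul_assoc, ι_mul_t, ← mul_assoc, D.t_mul_t, c_mul_ι_mk, zero_add, ι_mem_iff]
    have key : ∀ u : ZMod 2, u = 1 ↔ u + 1 = 0 := by decide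
    exact key _
  · show (ty D (rt c D.t Ψ)).2.2 s = 0 ↔ (ty D Ψ).1.2 s = 0
    rw [← tyι_mem_iff, mem_rt, mul_assoc, mul_assoc, ι_mul_t, ← mul_assoc, ← mul_assoc, t_mul_y_mul_t, yι_mem_iff]

omit [Fintype A] [DecidableEq A] in
/-- **Conjugation is the model's conjugation**: `ty (Ψ·c) = twH₄ (1,0) (ty Ψ)`. [folklore] -/
theorem ty_rt_c (Ψ : CMF G c) : ty D (rt c c Ψ) = twH₄ A (1, 0) (ty D Ψ) := by
  rw [← ty_rt_ι, D.map_c]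

omit [DecidableEq A] in
/-- Types of diagonally moved labels: `typeOf (twH₄ a Θ) = (typeOf Θ)·(ι a)⁻¹`. [folklore] -/
theorem typeOf_twH₄ (a : ZMod 2 × A) (Θ : Ty₄ A) : typeOf D (twH₄ A a Θ) = rt c (D.ι a) (typeOf D Θ) := by
  apply ty_injective D
  rw [ty_typeOf, ty_rt_ι, ty_typeOf]

omit [DecidableEq A] in
/-- Types of `y`-moved labels: `typeOf (twY ζ Θ) = (typeOf Θ)·y⁻¹`. [folklore] -/
theorem typeOf_twY (Θ : Ty₄ A) : typeOf D (twY A ζ Θ) = rt c D.y (typeOf D Θ) := by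
  apply ty_injective D
  rw [ty_typeOf, ty_rt_y, ty_typeOf]

omit [DecidableEq A] in
/-- Types of `t`-moved labels: `typeOf (twT Θ) = (typeOf Θ)·t⁻¹`. [folklore] -/
theorem typeOf_twT (Θ : Ty₄ A) : typeOf D (twT A Θ) = rt c D.t (typeOf D Θ) := by
  apply ty_injective D
  rw [ty_typeOf, ty_rt_t, ty_typeOf]

end

end Summit.HodgeConjecture.CorCM.Census.QuarticInversion
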